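import Summits.BirchSwinnertonDyer.Rank1Residual.GaloisImage.KolyvaginCoreEdges
import HarnessLib

/-!
# Kolyvagin systems at `m = 1`: transport of vanishing along the edges of `X⁰`, core vertices above
# every level, and the prime choice over `H¹(K, T̄)` through the residual self-duality
# (Rubin, PCMI Def. 2.8.6 / Prop. 2.3.2, Cor. 2.7.3–2.7.4, Prop. 2.7.1; Sakamoto, JTNB 36 (2024) §6, Cor. 5.5)
# (cell `b2b-bsdres`, team n1011, row T-R1-56-G, file G2; seat p11; skeleton `cells/n1011/skel/T-R1-56-G.md`)

HONEST FRAMING (verbatim for the cell): research route; prove what is provable now; no claim beyond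
stated classes; nothing booked; no mark / label moved.  TOOL theorems about Kolyvagin systems of a
finite Galois module killed by `p`; theorems only — no definition, no named fact.  The prime-choice
input (Chebotarev; at `p = 3` Sakamoto's Cor. 5.5, a THEOREM of the tree, T-C55K p271663) is an
explicit HYPOTHESIS in R1-16's shapes.  RIGIDITY itself (Rubin Thm. 2.8.4 at `m = 1`: `κ_n = 0` off
the core vertices) is row T-R1-56-K6's `CoreRankZero.apply_eq_zero_of_dualSelmerGroup_atLevel_ne_bot`
(p09, `KolyvaginStubVanishing.lean`; lead R5-65 DUP-1: one producer) and is NOT restated here.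

Setting of R1-16 (`CoreRankZero.kolyvaginSystems_eq_bot_of_hasCoreRank_zero`): `K` a number field,
`M = T̄` finite killed by the prime `p`, `inv` a Poitou–Tate family, `𝓕` unramified outside `S` with
finite Selmer and dual Selmer groups, `D` a Kolyvagin datum with `𝒫 ∩ S = ∅`, admissible comparison
maps, the local shape `#H¹_ur = #H¹_tr = p`, `H¹ = H¹_ur + H¹_tr` at `𝒫`; `H(n) = H¹_{𝓕(n)}`,
`H^*(n) = H¹_{𝓕(n)^*}`; CORE = `H^*(n) = 0`.
* §7 **transport of vanishing along an edge of `X⁰`**: if `n` is core, `𝔮 ∈ 𝒫 ∖ n` and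
  `loc_𝔮 H(n) ≠ 0`, then `κ_{n𝔮} = 0 ↔ κ_n = 0` for every `κ ∈ KS₁(T̄, 𝓕, 𝒫)` (Rubin Def. 2.8.6 /
  Prop. 2.3.2: on `X⁰` both vertex-to-edge maps are isomorphisms) — the edge-invariance `hQ` of the
  predicate `Q n := (κ_n = 0)` used by the connectivity files G3–G5;
* §8 **core vertices exist above every level** when `χ(𝓕) = 1` (Rubin Cor. 2.7.3–2.7.4);
* §9 the prime choice over classes of `H¹(K, M)` only (Sakamoto Cor. 5.5's shape, two classes) yields
  Rubin's mixed prime choice `hprime` through `θ′ : M^D → M` (R1-16 `_of_selfDual` pattern).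

## References
* [Rubin2011] K. Rubin, *Euler systems and Kolyvagin systems*, IAS/Park City Math. Ser. 18 (2011),
  Prop. 2.3.2, Prop. 2.7.1, Cor. 2.7.2–2.7.4, Def. 2.8.6 (pp. 19–25) — read (held,
  doi:10.1090/pcms/018/14).
* [Sakamoto2024] R. Sakamoto, JTNB 36 (2024), Cor. 5.5 (p. 929), §6 (p. 930) — read (OA PDF).
* B. Mazur, K. Rubin, Mem. AMS 799 (2004), §4.3 — cited through [Rubin2011] (not held). -/

noncomputable section

open scoped Classical NumberField ContRepresentation
open Function NumberField IsDedekindDomain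
open Literature.NumberTheory.GaloisRepresentations Literature.NumberTheory.GaloisRepresentations.DiscreteGaloisModule
  Literature.NumberTheory.GaloisCohomology
open Summit.BirchSwinnertonDyer.Rank1Residual.GaloisImage.CoreRankZero
open Summit.BirchSwinnertonDyer.Rank1Residual.X11b.Levels

universe u

namespace Summit.BirchSwinnertonDyer.Rank1Residual.GaloisImage.CoreRankOne

variable {K : Type u} [Field K] [NumberField K]
variable {M : Type u} [AddCommGroup M] [TopologicalSpace M] [DiscreteTopology M] [Finite M]
variable {ρ : DiscreteGaloisModule K M}

/-! ## §7. Transport of vanishing along an edge of `X⁰` -/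

/-- **Along an edge of `X⁰` a Kolyvagin system vanishes at both ends or at neither** (Rubin
Def. 2.8.6 / Prop. 2.3.2: on `X⁰` both vertex-to-edge maps are isomorphisms, so a global section is
determined along edges).  At `m = 1`: if `n` is a core vertex, `𝔮 ∈ 𝒫 ∖ n` and some class of `H(n)`
is non-zero at `𝔮`, then for `κ ∈ KS₁(T̄, 𝓕, 𝒫)`: `κ_{n𝔮} = 0 ↔ κ_n = 0` (→: `H(n) ∩ ker loc_𝔮 = 0`
and Rubin Cor. 2.7.2 `loc_𝔮 κ_n ≠ 0 ⟹ loc_𝔮 κ_{n𝔮} ≠ 0`; ←: the finite–singular relation gives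
`v_𝔮(κ_{n𝔮}) = φ^{fs}_𝔮(0) = 0`, so `loc_𝔮 κ_{n𝔮} ∈ H¹_ur ∩ H¹_tr = 0`, and `loc_𝔮` is injective on
`H(n𝔮)` by (M1)). [cite: Rubin2011, Def. 2.8.6 and Prop. 2.3.2 (pp. 19, 25)]
[cite: Sakamoto2024, §6 (p. 930)] -/
theorem apply_insert_eq_zero_iff_of_edge {p : ℕ} [Fact p.Prime] {inv : LocalInvariants K p}
    (hperf : inv.IsPerfect) (hsum : inv.SumLocalTermEqZero) (hcompl : inv.SelmerComplement)
    (hM : ∀ m : M, p • m = 0) {S : Finset (Place K)}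
    (hS : ∀ v : HeightOneSpectrum (𝓞 K), (Sum.inr v : Place K) ∉ S →
      ((p : ℕ) : 𝓞 K) ∉ v.asIdeal ∧ GaloisRep.IsUnramifiedAt v ρ)
    {𝓕 : SelmerStructure ρ} (h𝓕 : 𝓕.IsUnramifiedOutside S)
    (hfin : Finite 𝓕.selmerGroup) (hfind : Finite (inv.dualSelmerStructure ρ 𝓕).selmerGroup)
    (hχ : LocalInvariants.HasCoreRank inv 𝓕 p 1)
    {D : KolyvaginDatum ρ} (hPS : ∀ q ∈ D.primes, (Sum.inr q : Place K) ∉ S)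
    (hadm : D.IsAdmissible)
    (hU : ∀ q ∈ D.primes, Nat.card (unramifiedSubgroup (GaloisRep.toLocal q ρ) 1) = p)
    (hT : ∀ q ∈ D.primes, Nat.card (D.transverse (Sum.inr q)) = p)
    (hUT : ∀ q ∈ D.primes,
      unramifiedSubgroup (GaloisRep.toLocal q ρ) 1 ⊔ D.transverse (Sum.inr q) = ⊤)
    {n : Finset (HeightOneSpectrum (𝓞 K))} (hn : D.IsLevel n)
    (hcore : (inv.dualSelmerStructure ρ (D.atLevel 𝓕 n)).selmerGroup = ⊥)
    {q : HeightOneSpectrum (𝓞 K)} (hq : q ∈ D.primes) (hqn : q ∉ n)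
    {x : galoisCohomology ρ 1} (hx : x ∈ (D.atLevel 𝓕 n).selmerGroup)
    (hxq : galoisCohomology.localization ρ (Sum.inr q) 1 x ≠ 0)
    {κ : Finset (HeightOneSpectrum (𝓞 K)) → galoisCohomology ρ 1} (hκ : D.IsKolyvaginSystem 𝓕 κ) :
    κ (insert q n) = 0 ↔ κ n = 0 := by
  have hp : p.Prime := Fact.out
  have hcardn := natCard_selmerGroup_atLevel_of_core hperf hsum hcompl hM hS h𝓕 hfin hfind hχ hPS hU
    hT hn hcore
  have hinj := (core_insert_of_localization_ne_zero hperf hsum hcompl hM hS h𝓕 hfin hfind hχ hPS hU hT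
    hn hcore hq hx hxq).2
  have hκn := hκ.mem_selmerGroup n hn
  have hκnq := hκ.mem_selmerGroup _ (hn.insert hq)
  constructor
  · -- `κ_{n𝔮} = 0 ⟹ loc_𝔮 κ_n = 0 ⟹ κ_n = 0`
    intro h0
    by_contra hne
    have hker : (D.atLevel 𝓕 n).selmerGroup ⊓ (galoisCohomology.localization ρ (Sum.inr q) 1).ker = ⊥ :=
      eq_bot_of_le_of_natCard_eq_prime_of_not_mem hp inf_le_left hcardn hx
        fun h => hxq ((AddMonoidHom.mem_ker).1 h.2)
    have hloc : galoisCohomology.localization ρ (Sum.inr q) 1 (κ n) ≠ 0 := by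
      intro h
      have hmem : κ n ∈ (D.atLevel 𝓕 n).selmerGroup ⊓
          (galoisCohomology.localization ρ (Sum.inr q) 1).ker := ⟨hκn, (AddMonoidHom.mem_ker).2 h⟩
      rw [hker, AddSubgroup.mem_bot] at hmem
      exact hne hmem
    have hstep := apply_insert_ne_zero_of_localization_ne_zero h𝓕 hPS hadm hκ hn hq hqn hloc
    exact hstep (by rw [h0, map_zero])
  · -- `κ_n = 0 ⟹ v_𝔮(κ_{n𝔮}) = 0 ⟹ loc_𝔮 κ_{n𝔮} ∈ H¹_ur ∩ H¹_tr = 0 ⟹ κ_{n𝔮} = 0`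
    intro h0
    have hrel := hκ.fs_rel n hn q hq hqn
    have hL : KolyvaginDatum.singularLocalization ρ q (κ (insert q n)) =
        singularMap (GaloisRep.toLocal q ρ)
          (galoisCohomology.localization ρ (Sum.inr q) 1 (κ (insert q n))) := rfl
    rw [hL, h0, map_zero, singularMap_eq_zero_iff] at hrel
    have hmemT : galoisCohomology.localization ρ (Sum.inr q) 1 (κ (insert q n)) ∈
        D.transverse (Sum.inr q) := by
      have h := (SelmerStructure.mem_selmerGroup_iff _ _).1 hκnq (Sum.inr q)
      rwa [Level.atLevel_insert_inr_self] at h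
    have hmem : (galoisCohomology.localization ρ (Sum.inr q) 1 (κ (insert q n)) :
        galoisCohomology (GaloisRep.toLocal q ρ) 1) ∈
          unramifiedSubgroup (GaloisRep.toLocal q ρ) 1 ⊓ D.transverse (Sum.inr q) :=
      AddSubgroup.mem_inf.2 ⟨hrel, hmemT⟩
    rw [unramified_inf_transverse_eq_bot hadm hU hT hUT hq] at hmem
    exact hinj _ hκnq ((AddSubgroup.mem_bot (G := galoisCohomology (GaloisRep.toLocal q ρ) 1)).1 hmem)

/-! ## §8. Core vertices exist above every level (Rubin Cor. 2.7.3–2.7.4 at `χ = 1`, `m = 1`) -/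

/-- **Every level lies in a core vertex** when `χ(𝓕) = 1`: while `H^*(n) ≠ 0`, the prime choice on a
non-zero class of `H(n)` (non-empty, `#H(n) = p·#H^*(n)`) and a non-zero class of `H^*(n)` gives `𝔮`
with `#H^*(n𝔮) < #H^*(n)` (Rubin Cor. 2.7.2–2.7.3: "there is a core vertex `n₀` and a path of length
`min{λ(n,Ā), λ(n,Ā^*)}` from `n` to `n₀`"). [cite: Rubin2011, Cor. 2.7.3 and Cor. 2.7.4 (p. 24)] -/
theorem exists_core_superset {p : ℕ} [Fact p.Prime] {inv : LocalInvariants K p}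
    (hperf : inv.IsPerfect) (hsum : inv.SumLocalTermEqZero) (hcompl : inv.SelmerComplement)
    (hM : ∀ m : M, p • m = 0) {S : Finset (Place K)}
    (hS : ∀ v : HeightOneSpectrum (𝓞 K), (Sum.inr v : Place K) ∉ S →
      ((p : ℕ) : 𝓞 K) ∉ v.asIdeal ∧ GaloisRep.IsUnramifiedAt v ρ)
    {𝓕 : SelmerStructure ρ} (h𝓕 : 𝓕.IsUnramifiedOutside S)
    (hfin : Finite 𝓕.selmerGroup) (hfind : Finite (inv.dualSelmerStructure ρ 𝓕).selmerGroup)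
    (hχ : LocalInvariants.HasCoreRank inv 𝓕 p 1)
    {D : KolyvaginDatum ρ} (hPS : ∀ q ∈ D.primes, (Sum.inr q : Place K) ∉ S)
    (hU : ∀ q ∈ D.primes, Nat.card (unramifiedSubgroup (GaloisRep.toLocal q ρ) 1) = p)
    (hT : ∀ q ∈ D.primes, Nat.card (D.transverse (Sum.inr q)) = p)
    (hUT : ∀ q ∈ D.primes,
      unramifiedSubgroup (GaloisRep.toLocal q ρ) 1 ⊔ D.transverse (Sum.inr q) = ⊤)
    (hprime : ∀ d, D.IsLevel d → ∀ c ∈ (D.atLevel 𝓕 d).selmerGroup,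
      ∀ c' ∈ (inv.dualSelmerStructure ρ (D.atLevel 𝓕 d)).selmerGroup, c ≠ 0 → c' ≠ 0 →
        ∃ q ∈ D.primes, q ∉ d ∧ galoisCohomology.localization ρ (Sum.inr q) 1 c ≠ 0 ∧
          galoisCohomology.localization (ρ.tateDual p) (Sum.inr q) 1 c' ≠ 0)
    {n : Finset (HeightOneSpectrum (𝓞 K))} (hn : D.IsLevel n) :
    ∃ d, n ⊆ d ∧ D.IsLevel d ∧ (inv.dualSelmerStructure ρ (D.atLevel 𝓕 d)).selmerGroup = ⊥ := by
  have hp : p.Prime := Fact.out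
  suffices h : ∀ (N : ℕ) (n : Finset (HeightOneSpectrum (𝓞 K))), D.IsLevel n →
      Nat.card (inv.dualSelmerStructure ρ (D.atLevel 𝓕 n)).selmerGroup = N →
        ∃ d, n ⊆ d ∧ D.IsLevel d ∧ (inv.dualSelmerStructure ρ (D.atLevel 𝓕 d)).selmerGroup = ⊥ from
    h _ n hn rfl
  intro N
  induction N using Nat.strong_induction_on with
  | _ N ih =>
    intro n hn hN
    by_cases hbot : (inv.dualSelmerStructure ρ (D.atLevel 𝓕 n)).selmerGroup = ⊥
    · exact ⟨n, subset_rfl, hn, hbot⟩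
    · haveI := finite_selmerGroup_atLevel D 𝓕 hfin n
      obtain ⟨y, hy, hy0⟩ := (AddSubgroup.bot_or_exists_ne_zero _).resolve_left hbot
      -- `H(n) ≠ 0` since `#H(n) = p · #H^*(n) ≥ p`
      have hne : (D.atLevel 𝓕 n).selmerGroup ≠ ⊥ := by
        intro h
        have hc := natCard_selmerGroup_atLevel_eq_mul hperf hsum hcompl hM hS h𝓕 hfin hfind hχ hPS hU
          hT hn
        rw [h, AddSubgroup.card_bot] at hc
        haveI := finite_dualSelmerGroup_atLevel inv D 𝓕 hfind n
        have h1 : 1 ≤ Nat.card (inv.dualSelmerStructure ρ (D.atLevel 𝓕 n)).selmerGroup := Nat.card_pos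
        have : p ≤ 1 := by
          calc p = p * 1 := (mul_one p).symm
            _ ≤ p * Nat.card (inv.dualSelmerStructure ρ (D.atLevel 𝓕 n)).selmerGroup :=
                Nat.mul_le_mul_left p h1
            _ = 1 := hc.symm
        exact absurd hp.one_lt (not_lt.2 this)
      obtain ⟨x, hx, hx0⟩ := (AddSubgroup.bot_or_exists_ne_zero _).resolve_left hne
      obtain ⟨q, hq, hqn, hxq, hyq⟩ := hprime n hn x hx y hy hx0 hy0
      have hlt := card_dualSelmerGroup_atLevel_insert_lt hperf hsum hcompl hM hS h𝓕 hfin hfind hPS hU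
        hUT n hq hqn hx hxq hy hyq
      obtain ⟨d, hnd, hd, hdcore⟩ := ih _ (hN ▸ hlt) (insert q n) (hn.insert hq) rfl
      exact ⟨d, (Finset.subset_insert q n).trans hnd, hd, hdcore⟩

/-! ## §9. The prime choice over `H¹(K, T̄)` only, through the residual self-duality `θ` -/

section Theta

variable {p : ℕ} (θ : ρ.toContRepresentation →ⁱL (ρ.tateDual p).toContRepresentation)
  (θ' : (ρ.tateDual p).toContRepresentation →ⁱL ρ.toContRepresentation)

/-- **The mixed prime choice from Sakamoto's Cor. 5.5 shape.**  If `θ : T̄ → T̄^D` has a two-sided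
inverse `θ′` (residual self-duality (H.SD)) and for any two non-zero classes of `H¹(K, T̄)` infinitely
many `𝔮 ∈ 𝒫` see both (T-C55K p271663's shape, two of three classes), then the prime-choice
hypothesis `hprime` of Rubin's Prop. 2.7.1 (a class of `H¹_{𝓕(d)}` and a DUAL class, outside any
level `d`) follows: transport the dual class by `H¹(θ′)` (injective) and use naturality of
localisation (R1-16 `localization_map_one_eq`). [cite: Sakamoto2024, Cor. 5.5 (p. 929)]
[cite: Rubin2011, Prop. 2.7.1 (p. 23)] -/
theorem hprime_of_localization_pair_infinite (hθ'θ : ∀ b, θ (θ' b) = b)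
    {𝓕 : SelmerStructure ρ} {inv : LocalInvariants K p} {D : KolyvaginDatum ρ}
    (hch : ∀ c₁ c₂ : galoisCohomology ρ 1, c₁ ≠ 0 → c₂ ≠ 0 →
      {q ∈ D.primes | galoisCohomology.localization ρ (Sum.inr q) 1 c₁ ≠ 0 ∧
        galoisCohomology.localization ρ (Sum.inr q) 1 c₂ ≠ 0}.Infinite) :
    ∀ d, D.IsLevel d → ∀ c ∈ (D.atLevel 𝓕 d).selmerGroup,
      ∀ c' ∈ (inv.dualSelmerStructure ρ (D.atLevel 𝓕 d)).selmerGroup, c ≠ 0 → c' ≠ 0 →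
        ∃ q ∈ D.primes, q ∉ d ∧ galoisCohomology.localization ρ (Sum.inr q) 1 c ≠ 0 ∧
          galoisCohomology.localization (ρ.tateDual p) (Sum.inr q) 1 c' ≠ 0 := by
  intro d _ c _ c' _ hc hc'
  have hc'' : galoisCohomology.map θ' 1 c' ≠ 0 := fun h =>
    hc' (map_injective_of_comp_eq θ' θ hθ'θ (by rw [h, map_zero]))
  obtain ⟨q, ⟨hq, hcq, hc'q⟩, hqd⟩ := (hch c _ hc hc'').exists_notMem_finset d
  refine ⟨q, hq, hqd, hcq, fun h0 => hc'q ?_⟩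
  rw [localization_map_one_eq, h0]
  exact map_zero _

end Theta

end Summit.BirchSwinnertonDyer.Rank1Residual.GaloisImage.CoreRankOne

end
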